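import Mathlib
import HarnessLib

/-!
# `HeckeEigenvalueField` (stmt-Langlands-13632), line `BaireSketch`, stub (S3): both countability
# hypotheses are load-bearing — negative lemmas (refuter, cdisprove cycle 1; `--supports` file)

Stub (S3) of the picked line (`Cruxes/HeckeEigenvalueField/Lines/BaireSketch.lean`, `stub_S3`) reads:
for a subfield `M ⊆ ℂ` with `#M ≤ ℵ₀` and a family `a : ι → ℂ` with `ι` COUNTABLE, one automorphism
`σ ∈ Aut(ℂ/ℚ)` moves every transcendental `a v` off `M`.  It is true (transcendence bases; see the
disprover's sketch in `Cruxes/HeckeEigenvalueField/Disproof.lean`).  This file records, sorry-free, that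
neither countability hypothesis can be dropped, so that any proof must use both:

* `stub_S3_false_without_countable_subfield` — without `#M ≤ ℵ₀` take `M = ⊤` and one transcendental
  value: nothing can be moved off `ℂ`.
* `stub_S3_false_without_countable_index` — without `Countable ι` take `M = ℚ(τ)` (`τ` transcendental,
  countable field) and `a = id : ℂ → ℂ`: for every `σ` the transcendental `σ⁻¹(τ)` is moved INTO `M`.

(The line instantiates `ι = places × Fin (n+1)` and `M =` the closure of a countable set, so both
hypotheses are met there; these lemmas only fence the stub.)  Transcendental numbers are produced by
Cantor's count (algebraic numbers are countable, `ℝ ↪ ℂ` is not), Mathlib only.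
-/

namespace Summit.Langlands.Langlands.Theorems.HeckeEigenvalueField.Negative

/-- **(S3) needs `#M ≤ ℵ₀`.** With `M = ⊤` and a single transcendental value the conclusion
`σ (a v) ∉ M` is impossible. [folklore] -/
theorem stub_S3_false_without_countable_subfield :
    ¬ ∀ (M : Subfield ℂ) (ι : Type) [Countable ι] (a : ι → ℂ),
        ∃ σ : ℂ ≃ₐ[ℚ] ℂ, ∀ v, Transcendental ℚ (a v) → σ (a v) ∉ M := by
  intro h
  -- a transcendental complex number (Cantor: algebraic numbers are countable, `ℝ` is not)
  obtain ⟨τ, hτ⟩ : ∃ τ : ℂ, Transcendental ℚ τ := by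
    have hA : {x : ℂ | IsAlgebraic ℚ x}.Countable := by
      have h := @Algebra.IsAlgebraic.cardinalMk_le_max ℚ _ _ (algebraicClosure ℚ ℂ) _ _
        (algebraicClosure ℚ ℂ).algebra _ (algebraicClosure.isAlgebraic ℚ ℂ)
      have h' : Cardinal.mk (algebraicClosure ℚ ℂ) ≤ Cardinal.aleph0 := by simpa using h
      have hc : ((algebraicClosure ℚ ℂ : IntermediateField ℚ ℂ) : Set ℂ).Countable :=
        Cardinal.le_aleph0_iff_set_countable.mp h'
      convert hc using 1
      ext x
      simp [mem_algebraicClosure_iff]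
    by_contra hall
    have huniv : (Set.univ : Set ℂ).Countable := hA.mono fun x _ => by
      by_contra hx
      exact hall ⟨x, hx⟩
    have hR : (Set.univ : Set ℝ).Countable := by
      simpa using huniv.preimage Complex.ofReal_injective
    exact Cardinal.not_countable_real hR
  obtain ⟨σ, hσ⟩ := h ⊤ Unit (fun _ => τ)
  exact hσ () hτ (Subfield.mem_top _)

/-- **(S3) needs `Countable ι`.** With `M = ℚ(τ)` for a transcendental `τ` (a countable subfield) and the
uncountable family `a = id : ℂ → ℂ`, every `σ ∈ Aut(ℂ/ℚ)` moves the transcendental `σ⁻¹ τ` into `M`.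
[folklore] -/
theorem stub_S3_false_without_countable_index :
    ¬ ∀ (M : Subfield ℂ), Cardinal.mk M ≤ Cardinal.aleph0 →
        ∀ (ι : Type) (a : ι → ℂ),
          ∃ σ : ℂ ≃ₐ[ℚ] ℂ, ∀ v, Transcendental ℚ (a v) → σ (a v) ∉ M := by
  intro h
  -- a transcendental complex number (Cantor: algebraic numbers are countable, `ℝ` is not)
  obtain ⟨τ, hτ⟩ : ∃ τ : ℂ, Transcendental ℚ τ := by
    have hA : {x : ℂ | IsAlgebraic ℚ x}.Countable := by
      have h := @Algebra.IsAlgebraic.cardinalMk_le_max ℚ _ _ (algebraicClosure ℚ ℂ) _ _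
        (algebraicClosure ℚ ℂ).algebra _ (algebraicClosure.isAlgebraic ℚ ℂ)
      have h' : Cardinal.mk (algebraicClosure ℚ ℂ) ≤ Cardinal.aleph0 := by simpa using h
      have hc : ((algebraicClosure ℚ ℂ : IntermediateField ℚ ℂ) : Set ℂ).Countable :=
        Cardinal.le_aleph0_iff_set_countable.mp h'
      convert hc using 1
      ext x
      simp [mem_algebraicClosure_iff]
    by_contra hall
    have huniv : (Set.univ : Set ℂ).Countable := hA.mono fun x _ => by
      by_contra hx
      exact hall ⟨x, hx⟩
    have hR : (Set.univ : Set ℝ).Countable := by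
      simpa using huniv.preimage Complex.ofReal_injective
    exact Cardinal.not_countable_real hR
  have hM : Cardinal.mk (Subfield.closure ({τ} : Set ℂ)) ≤ Cardinal.aleph0 := by
    refine (Subfield.cardinalMk_closure_le_max ({τ} : Set ℂ)).trans ?_
    refine max_le ?_ le_rfl
    rw [Cardinal.mk_singleton]
    exact Cardinal.one_le_aleph0
  obtain ⟨σ, hσ⟩ := h (Subfield.closure {τ}) hM ℂ id
  refine hσ (σ.symm τ) ?_ ?_
  · intro halg
    apply hτ
    simpa using halg.algHom (σ : ℂ →ₐ[ℚ] ℂ)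
  · change σ (σ.symm τ) ∈ Subfield.closure ({τ} : Set ℂ)
    rw [AlgEquiv.apply_symm_apply]
    exact Subfield.subset_closure rfl

end Summit.Langlands.Langlands.Theorems.HeckeEigenvalueField.Negative
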